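import Summits.QuantumFields.GaugeBoot.TiltedRPGeometry
import HarnessLib

/-!
# Tilted diagonal frames: the four plaquette classes (gauge-boot, L3(σ) part 3)

HONEST FRAMING (cell `pub-gaugeboot`, page 1 of every file): the venture produces certified bounds
on lattice expectations at stated coupling, gauge group, dimension and torus size; NOT a mass gap,
NOT a continuum limit, NOT a string tension; NOT Yang–Mills-summit-bearing (barriers
`FixedCouplingUltralocality`, `PerturbativeInvisibility`).

Continuation of `TiltedRPGeometry.lean`. For a tilted diagonal frame `IsTiltedFrame e i j θ P v`
on a periodic lattice (mirror `θ`, height `v` with values read in `[0, 2P)`, closed half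
`{0 ≤ v ≤ P}`, layers `v = 0` and `v = P`), the plaquettes `p = (x, ⟨(k, l), k < l⟩)` fall into
four classes, exactly as for the hyperplane `x_i = x_j` of `ℤ^d` in `DiagonalRPGeometry.lean` but
now with TWO cutting layers:

* `IsCutPlaq` — an `(i, j)`-plaquette based in a layer: the layer passes through two of its corners
  and cuts it along the diagonal (heights `c - 1, c, c, c + 1` with `c ∈ {0, P}`);
* `IsMirrorPlaq` — a plaquette lying inside a layer (base in a layer, no side along `e i`, `e j`);
* `IsPosPlaq` — all four links in the closed half and not a mirror plaquette (in terms of the base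
  height `c`: `1 ≤ c` if the plaquette has a `j`-side or no `i`-side, `c + 1 ≤ P` if it has an
  `i`-side or no `j`-side, `c ≤ P` if it has a `j`-side and no `i`-side);
* `IsNegPlaq` — the rest (by definition), i.e. the mirror images of the positive plaquettes
  (`isPosPlaq_plaqSwap_iff`).

`plaqSwap` (base point `θx`, directions swapped and re-ordered) is an involution exchanging positive
and negative plaquettes and preserving the cut and the mirror classes, fixing mirror plaquettes;
the links of positive plaquettes are half links, those of mirror plaquettes are mirror links
(`TiltedRPGeometry.lean`). Pure combinatorics; holonomies follow in `TiltedRPCut.lean`.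

References: K. Osterwalder, E. Seiler, Ann. Phys. 110 (1978) 440, §2; J. Fröhlich, R. Israel,
E. H. Lieb, B. Simon, J. Stat. Phys. 22 (1980) 297, §3.
-/

namespace Summit.QuantumFields.GaugeBoot

namespace TiltedRP

variable {A : Type*} [AddCommGroup A] {d : ℕ}

/-! ## Directions and the plaquette swap -/

/-- `p` has a side in direction `m`. -/
def HasDir (p : Plaq A d) (m : Fin d) : Prop := p.2.1.1 = m ∨ p.2.1.2 = m

/-- The mirror image of a plaquette: base point `θx`, directions `{(i j) k, (i j) l}` (re-ordered). -/
def plaqSwap (i j : Fin d) (θ : A →+ A) (p : Plaq A d) : Plaq A d :=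
  if h : Equiv.swap i j p.2.1.1 < Equiv.swap i j p.2.1.2 then
    (θ p.1, ⟨(Equiv.swap i j p.2.1.1, Equiv.swap i j p.2.1.2), h⟩)
  else
    (θ p.1, ⟨(Equiv.swap i j p.2.1.2, Equiv.swap i j p.2.1.1),
      lt_of_le_of_ne (not_lt.1 h) fun h' => p.2.2.ne ((Equiv.swap i j).injective h'.symm)⟩)

section Swap

variable (i j : Fin d) (θ : A →+ A)

/-- The base point of the mirror image. -/
@[simp] theorem plaqSwap_fst (p : Plaq A d) : (plaqSwap i j θ p).1 = θ p.1 := by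
  unfold plaqSwap; split_ifs <;> rfl

/-- The mirror image has a side in direction `m` iff the plaquette has one in direction `(i j) m`. -/
theorem hasDir_plaqSwap (p : Plaq A d) (m : Fin d) :
    HasDir (plaqSwap i j θ p) m ↔ HasDir p (Equiv.swap i j m) := by
  unfold plaqSwap HasDir
  split_ifs <;> simp only [Equiv.swap_apply_eq_iff]
  exact Or.comm

/-- Direction `i` of the image corresponds to direction `j`. -/
theorem hasDir_plaqSwap_left (p : Plaq A d) : HasDir (plaqSwap i j θ p) i ↔ HasDir p j := by
  rw [hasDir_plaqSwap, Equiv.swap_apply_left]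

/-- Direction `j` of the image corresponds to direction `i`. -/
theorem hasDir_plaqSwap_right (p : Plaq A d) : HasDir (plaqSwap i j θ p) j ↔ HasDir p i := by
  rw [hasDir_plaqSwap, Equiv.swap_apply_right]

/-- `plaqSwap` when the swap preserves the order of the two directions. -/
theorem plaqSwap_of_lt (x : A) {k l : Fin d} (hkl : k < l)
    (h : Equiv.swap i j k < Equiv.swap i j l) :
    plaqSwap i j θ (x, ⟨(k, l), hkl⟩) = (θ x, ⟨(Equiv.swap i j k, Equiv.swap i j l), h⟩) := by
  unfold plaqSwap
  simp only [dif_pos h]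

/-- `plaqSwap` when the swap reverses the order of the two directions. -/
theorem plaqSwap_of_not_lt (x : A) {k l : Fin d} (hkl : k < l)
    (h : ¬ Equiv.swap i j k < Equiv.swap i j l) :
    plaqSwap i j θ (x, ⟨(k, l), hkl⟩) = (θ x, ⟨(Equiv.swap i j l, Equiv.swap i j k),
      lt_of_le_of_ne (not_lt.1 h) fun h' => hkl.ne ((Equiv.swap i j).injective h'.symm)⟩) := by
  unfold plaqSwap
  simp only [dif_neg h]

end Swap

/-! ## The four classes -/

section Classes

variable (i j : Fin d) (P : ℕ) (v : A →+ ZMod (2 * P))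

/-- A CUT plaquette: an `(i, j)`-plaquette with base point in a layer; the layer passes through two
of its corners and cuts it along the diagonal. -/
def IsCutPlaq (p : Plaq A d) : Prop := IsLayer P v p.1 ∧ HasDir p i ∧ HasDir p j

/-- A MIRROR plaquette: all four links inside a layer. -/
def IsMirrorPlaq (p : Plaq A d) : Prop := IsLayer P v p.1 ∧ ¬ HasDir p i ∧ ¬ HasDir p j

/-- A POSITIVE plaquette: all four links in the closed half `{0 ≤ v ≤ P}` and not a mirror
plaquette, written out in terms of the base height `c = val (v x)`. -/
def IsPosPlaq (p : Plaq A d) : Prop :=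
  (HasDir p j ∨ ¬ HasDir p i → 1 ≤ (v p.1).val) ∧
    (HasDir p i ∨ ¬ HasDir p j → (v p.1).val + 1 ≤ P) ∧
    (HasDir p j ∧ ¬ HasDir p i → (v p.1).val ≤ P)

/-- A NEGATIVE plaquette: neither positive, nor cut, nor mirror (these are the mirror images of the
positive plaquettes, `isPosPlaq_plaqSwap_iff`). -/
def IsNegPlaq (p : Plaq A d) : Prop :=
  ¬ IsPosPlaq i j P v p ∧ ¬ IsCutPlaq i j P v p ∧ ¬ IsMirrorPlaq i j P v p

variable {i j P v}

/-- Cut and mirror are exclusive. -/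
theorem IsCutPlaq.not_isMirrorPlaq {p : Plaq A d} (h : IsCutPlaq i j P v p) :
    ¬ IsMirrorPlaq i j P v p := fun h' => h'.2.1 h.2.1

end Classes

namespace IsTiltedFrame

variable {e : Fin d → A} {i j : Fin d} {θ : A →+ A} {P : ℕ} {v : A →+ ZMod (2 * P)}
variable (hF : IsTiltedFrame e i j θ P v)
include hF

/-- `plaqSwap` is an involution. -/
@[simp] theorem plaqSwap_plaqSwap (p : Plaq A d) : plaqSwap i j θ (plaqSwap i j θ p) = p := by
  obtain ⟨x, ⟨⟨k, l⟩, hkl⟩⟩ := p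
  have hkl' : k < l := hkl
  by_cases h1 : Equiv.swap i j k < Equiv.swap i j l
  · rw [plaqSwap_of_lt i j θ x hkl' h1,
      plaqSwap_of_lt i j θ _ h1 (by simpa [Equiv.swap_apply_self] using hkl')]
    simp [Equiv.swap_apply_self, hF.invol]
  · rw [plaqSwap_of_not_lt i j θ x hkl' h1,
      plaqSwap_of_not_lt i j θ _ _ (by simpa [Equiv.swap_apply_self] using not_lt.2 hkl'.le)]
    simp [Equiv.swap_apply_self, hF.invol]

/-- Positive and cut are exclusive. -/
theorem not_isCutPlaq_of_isPosPlaq {p : Plaq A d} (h : IsPosPlaq i j P v p) :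
    ¬ IsCutPlaq i j P v p := by
  rintro ⟨hl, hI, hJ⟩
  have hl' := (hF.layer_iff_val p.1).1 hl
  obtain ⟨h1, h2, -⟩ := h
  have hP := hF.two_le
  have := h1 (Or.inl hJ)
  have := h2 (Or.inl hI)
  omega

/-- Positive and mirror are exclusive. -/
theorem not_isMirrorPlaq_of_isPosPlaq {p : Plaq A d} (h : IsPosPlaq i j P v p) :
    ¬ IsMirrorPlaq i j P v p := by
  rintro ⟨hl, hI, hJ⟩
  have hl' := (hF.layer_iff_val p.1).1 hl
  obtain ⟨h1, h2, -⟩ := h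
  have hP := hF.two_le
  have := h1 (Or.inr hI)
  have := h2 (Or.inr hJ)
  omega

omit hF in
/-- **The four classes exhaust the plaquettes, exclusively**: a plaquette is negative iff it is
neither positive, nor cut, nor mirror (by definition), and the other three are pairwise exclusive. -/
theorem plaqClass_cases (p : Plaq A d) :
    IsPosPlaq i j P v p ∨ IsNegPlaq i j P v p ∨ IsCutPlaq i j P v p ∨ IsMirrorPlaq i j P v p := by
  by_cases h1 : IsPosPlaq i j P v p
  · exact Or.inl h1
  · by_cases h2 : IsCutPlaq i j P v p
    · exact Or.inr (Or.inr (Or.inl h2))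
    · by_cases h3 : IsMirrorPlaq i j P v p
      · exact Or.inr (Or.inr (Or.inr h3))
      · exact Or.inr (Or.inl ⟨h1, h2, h3⟩)

/-- `plaqSwap` preserves the cut plaquettes. -/
theorem isCutPlaq_plaqSwap_iff (p : Plaq A d) :
    IsCutPlaq i j P v (plaqSwap i j θ p) ↔ IsCutPlaq i j P v p := by
  unfold IsCutPlaq IsLayer
  rw [hasDir_plaqSwap_left, hasDir_plaqSwap_right, plaqSwap_fst, hF.layer_map_iff]
  exact ⟨fun ⟨h1, h2, h3⟩ => ⟨h1, h3, h2⟩, fun ⟨h1, h2, h3⟩ => ⟨h1, h3, h2⟩⟩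

/-- `plaqSwap` preserves the mirror plaquettes. -/
theorem isMirrorPlaq_plaqSwap_iff (p : Plaq A d) :
    IsMirrorPlaq i j P v (plaqSwap i j θ p) ↔ IsMirrorPlaq i j P v p := by
  unfold IsMirrorPlaq IsLayer
  rw [hasDir_plaqSwap_left, hasDir_plaqSwap_right, plaqSwap_fst, hF.layer_map_iff]
  exact ⟨fun ⟨h1, h2, h3⟩ => ⟨h1, h3, h2⟩, fun ⟨h1, h2, h3⟩ => ⟨h1, h3, h2⟩⟩

/-- **`plaqSwap` carries negative plaquettes to positive ones** (the height computation
`val (v (θx)) = 2P - val (v x)` for `v x ≠ 0`). -/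
theorem isPosPlaq_plaqSwap_iff (p : Plaq A d) :
    IsPosPlaq i j P v (plaqSwap i j θ p) ↔ IsNegPlaq i j P v p := by
  have hP := hF.two_le
  have hc := val_lt_two_mul hP (v p.1)
  have hlay := hF.layer_iff_val p.1
  unfold IsNegPlaq IsPosPlaq IsCutPlaq IsMirrorPlaq IsLayer
  rw [hasDir_plaqSwap_left, hasDir_plaqSwap_right, plaqSwap_fst, hF.val_height_map, hlay]
  by_cases hI : HasDir p i <;> by_cases hJ : HasDir p j <;>
    simp only [hI, hJ, or_true, or_false, not_true, not_false_iff, and_true,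
      true_and, and_false, true_implies, false_implies, not_and, not_or] <;>
    split_ifs with h0 <;> omega

/-- `plaqSwap` carries positive plaquettes to negative ones. -/
theorem isNegPlaq_plaqSwap_iff (p : Plaq A d) :
    IsNegPlaq i j P v (plaqSwap i j θ p) ↔ IsPosPlaq i j P v p := by
  rw [← hF.isPosPlaq_plaqSwap_iff, hF.plaqSwap_plaqSwap]

/-- **Mirror plaquettes are fixed by `plaqSwap`.** -/
theorem plaqSwap_of_isMirrorPlaq {p : Plaq A d} (hp : IsMirrorPlaq i j P v p) :
    plaqSwap i j θ p = p := by
  obtain ⟨x, ⟨⟨k, l⟩, hkl⟩⟩ := p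
  obtain ⟨h1, h2, h3⟩ := hp
  simp only [HasDir, not_or] at h2 h3
  have hk : Equiv.swap i j k = k := Equiv.swap_apply_of_ne_of_ne h2.1 h3.1
  have hl : Equiv.swap i j l = l := Equiv.swap_apply_of_ne_of_ne h2.2 h3.2
  unfold plaqSwap
  simp only [hk, hl, dif_pos hkl, hF.map_of_isLayer h1]

/-- **Cut plaquettes are fixed by `plaqSwap`** (base point in a layer, plane `(i, j)`). -/
theorem plaqSwap_of_isCutPlaq {p : Plaq A d} (hp : IsCutPlaq i j P v p) :
    plaqSwap i j θ p = p := by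
  obtain ⟨x, ⟨⟨k, l⟩, hkl⟩⟩ := p
  obtain ⟨h1, hI, hJ⟩ := hp
  have hkl' : k < l := hkl
  simp only [HasDir] at hI hJ
  have hij := hF.ne
  rcases hI with rfl | rfl <;> rcases hJ with h | h
  · exact absurd h hij
  · subst h
    rw [plaqSwap_of_not_lt k l θ x hkl' (by
      rw [Equiv.swap_apply_left, Equiv.swap_apply_right]; exact not_lt.2 hkl'.le)]
    simp [hF.map_of_isLayer h1]
  · subst h
    rw [plaqSwap_of_not_lt l k θ x hkl' (by
      rw [Equiv.swap_apply_left, Equiv.swap_apply_right]; exact not_lt.2 hkl'.le)]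
    simp [hF.map_of_isLayer h1]
  · exact absurd h hij

/-! ## The links of the four classes -/

/-- Exact height along `e i` below the top: `val (v (x + e i)) = val (v x) + 1`. -/
theorem val_height_add_left_of (x : A) (h : (v x).val + 1 < 2 * P) :
    (v (x + e i)).val = (v x).val + 1 := by
  rw [hF.val_height_add_left, if_neg (by omega)]

/-- Exact height along `e j` above the bottom: `val (v (x + e j)) = val (v x) - 1`. -/
theorem val_height_add_right_of (x : A) (h : (v x).val ≠ 0) :
    (v (x + e j)).val = (v x).val - 1 := by
  rw [hF.val_height_add_right, if_neg h]

/-- `v (x + e i + e j) = v x`. -/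
theorem height_add_left_add_right (x : A) : v (x + e i + e j) = v x := by
  rw [hF.height_add_right, hF.height_add_left, add_sub_cancel_right]

/-- `v (x + e j + e i) = v x`. -/
theorem height_add_right_add_left (x : A) : v (x + e j + e i) = v x := by
  rw [add_right_comm, hF.height_add_left_add_right]

/-- An `i`-link based at height `c` with `c + 1 ≤ P` is a half link. -/
theorem isHalfLink_left {y : A} (h : (v y).val + 1 ≤ P) : IsHalfLink e P v (y, i) := by
  have hP := hF.two_le
  refine ⟨?_, ?_⟩ <;> unfold InHalf <;> simp only
  · omega
  · rw [hF.val_height_add_left_of y (by omega)]; exact h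

/-- A `j`-link based at height `c` with `1 ≤ c ≤ P` is a half link. -/
theorem isHalfLink_right {y : A} (h1 : 1 ≤ (v y).val) (h2 : (v y).val ≤ P) :
    IsHalfLink e P v (y, j) := by
  refine ⟨?_, ?_⟩ <;> unfold InHalf <;> simp only
  · exact h2
  · rw [hF.val_height_add_right_of y (by omega)]; omega

/-- A `k`-link, `k ∉ {i, j}`, based in the closed half is a half link. -/
theorem isHalfLink_other {y : A} {k : Fin d} (hki : k ≠ i) (hkj : k ≠ j) (h : (v y).val ≤ P) :
    IsHalfLink e P v (y, k) := by
  refine ⟨?_, ?_⟩ <;> unfold InHalf <;> simp only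
  · exact h
  · rw [hF.height_add_other y hki hkj]; exact h

/-- **All four links of a positive plaquette are links of the closed half.** -/
theorem isHalfLink_of_isPosPlaq {p : Plaq A d} (hp : IsPosPlaq i j P v p) :
    IsHalfLink e P v (p.1, p.2.1.1) ∧ IsHalfLink e P v (p.1 + e p.2.1.1, p.2.1.2) ∧
      IsHalfLink e P v (p.1 + e p.2.1.2, p.2.1.1) ∧ IsHalfLink e P v (p.1, p.2.1.2) := by
  obtain ⟨x, ⟨⟨k, l⟩, hkl⟩⟩ := p
  have hP := hF.two_le
  have hc := val_lt_two_mul hP (v x)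
  have hij := hF.ne
  have hkl' : k ≠ l := ne_of_lt hkl
  obtain ⟨h1, h2, h3⟩ := hp
  simp only [HasDir] at h1 h2 h3 ⊢
  rcases (by tauto : k = i ∨ k = j ∨ (k ≠ i ∧ k ≠ j)) with hk | hk | ⟨hki, hkj⟩ <;>
    rcases (by tauto : l = i ∨ l = j ∨ (l ≠ i ∧ l ≠ j)) with hl | hl | ⟨hli, hlj⟩ <;>
    (try subst hk) <;> (try subst hl)
  · exact absurd rfl hkl'
  · -- plane `(i, j)`
    have ha : 1 ≤ (v x).val := h1 (Or.inl (Or.inr rfl))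
    have hb : (v x).val + 1 ≤ P := h2 (Or.inl (Or.inl rfl))
    have hi : (v (x + e k)).val = (v x).val + 1 := hF.val_height_add_left_of x (by omega)
    have hj : (v (x + e l)).val = (v x).val - 1 := hF.val_height_add_right_of x (by omega)
    exact ⟨hF.isHalfLink_left hb, hF.isHalfLink_right (by rw [hi]; omega) (by rw [hi]; omega),
      hF.isHalfLink_left (by rw [hj]; omega), hF.isHalfLink_right ha (by omega)⟩
  · -- plane `(i, l)`, `l ∉ {i, j}`
    have hb : (v x).val + 1 ≤ P := h2 (Or.inl (Or.inl rfl))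
    have hi : (v (x + e k)).val = (v x).val + 1 := hF.val_height_add_left_of x (by omega)
    have ho : v (x + e l) = v x := hF.height_add_other x hli hlj
    exact ⟨hF.isHalfLink_left hb, hF.isHalfLink_other hli hlj (by rw [hi]; omega),
      hF.isHalfLink_left (by rw [ho]; exact hb), hF.isHalfLink_other hli hlj (by omega)⟩
  · -- plane `(j, i)`
    have ha : 1 ≤ (v x).val := h1 (Or.inl (Or.inl rfl))
    have hb : (v x).val + 1 ≤ P := h2 (Or.inl (Or.inr rfl))
    have hj : (v (x + e k)).val = (v x).val - 1 := hF.val_height_add_right_of x (by omega)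
    have hi : (v (x + e l)).val = (v x).val + 1 := hF.val_height_add_left_of x (by omega)
    exact ⟨hF.isHalfLink_right ha (by omega), hF.isHalfLink_left (by rw [hj]; omega),
      hF.isHalfLink_right (by rw [hi]; omega) (by rw [hi]; omega), hF.isHalfLink_left hb⟩
  · exact absurd rfl hkl'
  · -- plane `(j, l)`, `l ∉ {i, j}`
    have ha : 1 ≤ (v x).val := h1 (Or.inl (Or.inl rfl))
    have hb : (v x).val ≤ P := h3 ⟨Or.inl rfl, by
      rintro (h | h); exact hij.symm h; exact hli h⟩
    have hj : (v (x + e k)).val = (v x).val - 1 := hF.val_height_add_right_of x (by omega)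
    have ho : v (x + e l) = v x := hF.height_add_other x hli hlj
    exact ⟨hF.isHalfLink_right ha hb, hF.isHalfLink_other hli hlj (by rw [hj]; omega),
      hF.isHalfLink_right (by rw [ho]; exact ha) (by rw [ho]; exact hb),
      hF.isHalfLink_other hli hlj hb⟩
  · -- plane `(k, i)`, `k ∉ {i, j}`
    have hb : (v x).val + 1 ≤ P := h2 (Or.inl (Or.inr rfl))
    have ho : v (x + e k) = v x := hF.height_add_other x hki hkj
    have hi : (v (x + e l)).val = (v x).val + 1 := hF.val_height_add_left_of x (by omega)
    exact ⟨hF.isHalfLink_other hki hkj (by omega), hF.isHalfLink_left (by rw [ho]; exact hb),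
      hF.isHalfLink_other hki hkj (by rw [hi]; omega), hF.isHalfLink_left hb⟩
  · -- plane `(k, j)`, `k ∉ {i, j}`
    have ha : 1 ≤ (v x).val := h1 (Or.inl (Or.inr rfl))
    have hb : (v x).val ≤ P := h3 ⟨Or.inr rfl, by
      rintro (h | h); exact hki h; exact hij.symm h⟩
    have ho : v (x + e k) = v x := hF.height_add_other x hki hkj
    have hj : (v (x + e l)).val = (v x).val - 1 := hF.val_height_add_right_of x (by omega)
    exact ⟨hF.isHalfLink_other hki hkj hb, hF.isHalfLink_right (by rw [ho]; exact ha) (by rw [ho]; exact hb),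
      hF.isHalfLink_other hki hkj (by rw [hj]; omega), hF.isHalfLink_right ha hb⟩
  · -- plane `(k, l)`, both `∉ {i, j}`
    have ha : 1 ≤ (v x).val := h1 (Or.inr (by rintro (h | h); exact hki h; exact hli h))
    have hb : (v x).val + 1 ≤ P := h2 (Or.inr (by rintro (h | h); exact hkj h; exact hlj h))
    have hok : v (x + e k) = v x := hF.height_add_other x hki hkj
    have hol : v (x + e l) = v x := hF.height_add_other x hli hlj
    exact ⟨hF.isHalfLink_other hki hkj (by omega), hF.isHalfLink_other hli hlj (by rw [hok]; omega),
      hF.isHalfLink_other hki hkj (by rw [hol]; omega), hF.isHalfLink_other hli hlj (by omega)⟩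

/-- **All four links of a mirror plaquette are mirror links.** -/
theorem isMirrorLink_of_isMirrorPlaq {p : Plaq A d} (hp : IsMirrorPlaq i j P v p) :
    IsMirrorLink i j P v (p.1, p.2.1.1) ∧ IsMirrorLink i j P v (p.1 + e p.2.1.1, p.2.1.2) ∧
      IsMirrorLink i j P v (p.1 + e p.2.1.2, p.2.1.1) ∧ IsMirrorLink i j P v (p.1, p.2.1.2) := by
  obtain ⟨x, ⟨⟨k, l⟩, hkl⟩⟩ := p
  obtain ⟨h1, h2, h3⟩ := hp
  simp only [HasDir, not_or] at h1 h2 h3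
  unfold IsMirrorLink IsLayer
  simp only
  rw [hF.height_add_other x h2.1 h3.1, hF.height_add_other x h2.2 h3.2]
  unfold IsLayer at h1
  exact ⟨⟨h1, h2.1, h3.1⟩, ⟨h1, h2.2, h3.2⟩, ⟨h1, h2.1, h3.1⟩, ⟨h1, h2.2, h3.2⟩⟩

/-- All four links of a mirror plaquette are links of the closed half. -/
theorem isHalfLink_of_isMirrorPlaq {p : Plaq A d} (hp : IsMirrorPlaq i j P v p) :
    IsHalfLink e P v (p.1, p.2.1.1) ∧ IsHalfLink e P v (p.1 + e p.2.1.1, p.2.1.2) ∧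
      IsHalfLink e P v (p.1 + e p.2.1.2, p.2.1.1) ∧ IsHalfLink e P v (p.1, p.2.1.2) := by
  obtain ⟨h1, h2, h3, h4⟩ := hF.isMirrorLink_of_isMirrorPlaq hp
  exact ⟨hF.isHalfLink_of_isMirrorLink h1, hF.isHalfLink_of_isMirrorLink h2,
    hF.isHalfLink_of_isMirrorLink h3, hF.isHalfLink_of_isMirrorLink h4⟩

end IsTiltedFrame

end TiltedRP

end Summit.QuantumFields.GaugeBoot
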